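import Literature.Probability.RandomPlanarGeometry.PlusHullExtension
import Literature.Analysis.Complex.KoebeQuarterProofs
import Literature.Analysis.Complex.KoebeDistortion
import HarnessLib

/-!
# Uniform Koebe bounds for the extensions `E_A` of `Φ_A`, `A ∈ 𝒬₊` in a fixed annulus

Proof infrastructure (no new definitions, no named facts) for the continuity clause of
[LSW] Lemma 3.5 (`RestrictionContinuityProofs`):

* G. F. Lawler, O. Schramm, W. Werner, *Conformal restriction: the chordal case*, J. Amer. Math.
  Soc. **16** (2003) 917–955, arXiv:math/0209343 (**[LSW]**), proof of Lemma 3.5, p. 12: "It is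
  easy to verify that `A_n^+ ∪ A_n^-` is bounded and bounded away from `0`", where
  `A_n^+ = Φ_{A_n}(A ∖ A_n)`; this needs bounds on `Φ_{A_n}` UNIFORM in `n` for hulls `A_n` in a
  fixed annulus `{δ ≤ |z| ≤ 1/δ}`, which we take from Koebe's one-quarter theorem (the tree's
  `Literature.Analysis.Complex.koebeQuarter_holds`, Lawler (2005) Thm. 3.17) applied to the
  Schwarz-reflection extension `E_A` of `Φ_A` (`PlusHullExtension`: injective and holomorphic
  on `Ω_A = ℂ ∖ (A ∪ Ā ∪ [x₀, x₁])`, `E_A(0) = 0`, `E_A(z)/z → 1` at `∞`).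

All PROVED, for a nonempty `A ∈ 𝒬₊`:

* `ball_subset_image_of_injOn_ball` — Koebe's one-quarter theorem on a disc `B(c, R)`;
  `eventually_ball_subset_image` — if `f_n → id` uniformly on `B(u, r)` with `f_n` injective
  holomorphic, then eventually `B(u, r/8) ⊆ f_n(B(u, r))` (used for "`S` is contained in the
  image of `Φ_{A_n} ∘ Φ_A⁻¹`", [LSW] p. 12, in place of the argument principle);
* `IsPlusHull.ball_subset_plusDomain`, `.mem_plusDomain_of_lt_norm` — `B(0, δ) ⊆ Ω_A` if
  `A ⊆ {δ ≤ |z|}`, `{|z| > R} ⊆ Ω_A` if `A ⊆ B̄(0, R)`;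
* `IsPlusHull.hasDerivAt_extMap_zero` — `E_A'(0) = Φ_A'(0)`;
* `IsPlusHull.le_norm_extMap` — **Koebe at `0`**: `|E_A(w)| ≥ δ Φ_A'(0)/4` for `w ∈ Ω_A`,
  `|w| ≥ δ`, when `A ⊆ {δ ≤ |z|}`;
* `IsPlusHull.inverted_extMap`, `IsPlusHull.norm_extMap_le` — **Koebe at `∞`**: the inverted map
  `h(ζ) = 1/E_A(1/ζ)` is injective holomorphic on `B(0, δ)` with `h(0) = 0`, `h'(0) = 1`
  (removable singularity), whence `E_A({|z| > 2/δ}) ⊇ {|u| > 8/δ}` and, by injectivity,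
  `|E_A(w)| ≤ 8/δ` for `w ∈ Ω_A`, `|w| ≤ 2/δ`, when `A ⊆ B̄(0, 1/δ)`.

## References

* [LSW] proof of Lemma 3.5 (p. 12) [LawlerSchrammWerner2003Restriction].
* G. F. Lawler, *Conformally Invariant Processes in the Plane* (2005), Thm. 3.17 [Lawler2008].
-/

noncomputable section

open Set Filter Metric Bornology Complex
open _root_.Topology
open UpperHalfPlane (upperHalfPlaneSet isOpen_upperHalfPlaneSet)
open scoped ComplexConjugate

namespace Literature.Probability.RandomPlanarGeometry

/-! ### Koebe's one-quarter theorem on an arbitrary disc -/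

/-- **Koebe's one-quarter theorem on `B(c, R)`**: the image of `B(c, R)` under an injective
holomorphic `f` contains `B(f(c), R |f'(c)|/4)` (rescaling of the tree's `KoebeQuarter`,
`Literature.Analysis.Complex.koebeQuarter_holds`). [cite: Lawler2008, Thm. 3.17 (p. 62)] -/
theorem ball_subset_image_of_injOn_ball {f : ℂ → ℂ} {c : ℂ} {R : ℝ} (hR : 0 < R)
    (hf : DifferentiableOn ℂ f (ball c R)) (hinj : InjOn f (ball c R)) :
    ball (f c) (R * ‖deriv f c‖ / 4) ⊆ f '' ball c R := by
  obtain ⟨hFd, hFinj, hFderiv⟩ := Literature.Analysis.Complex.AreaThm.rescale_ball hR hf hinj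
  have hK := Literature.Analysis.Complex.koebeQuarter_holds _ hFd hFinj
  have h0 : deriv (fun ζ ↦ f (c + R * ζ)) 0 = R * deriv f c := by
    have := hFderiv 0 (mem_ball_self one_pos); simpa using this
  simp only [mul_zero, add_zero, h0, norm_mul, Complex.norm_real, Real.norm_eq_abs,
    abs_of_pos hR] at hK
  refine (by simpa [mul_div_assoc] using hK : ball (f c) (R * ‖deriv f c‖ / 4) ⊆ _).trans ?_
  rintro _ ⟨ζ, hζ, rfl⟩
  refine ⟨c + R * ζ, ?_, rfl⟩
  rw [mem_ball, dist_eq_norm, add_sub_cancel_left, norm_mul, Complex.norm_real, Real.norm_eq_abs,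
    abs_of_pos hR]
  rw [mem_ball_zero_iff] at hζ
  nlinarith

/-- **Covering by maps close to the identity**: if `f_n → id` uniformly on `B(u, r)` and the
`f_n` are eventually injective and holomorphic there, then eventually `B(u, r/8) ⊆ f_n(B(u, r))`
(Koebe's one-quarter theorem with `f_n(u) → u`, `f_n'(u) → 1`). [folklore] -/
theorem eventually_ball_subset_image {ι : Type*} {l : Filter ι} [l.NeBot] {f : ι → ℂ → ℂ} {u : ℂ}
    {r : ℝ} (hr : 0 < r) (hf : ∀ᶠ n in l, DifferentiableOn ℂ (f n) (ball u r) ∧ InjOn (f n) (ball u r))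
    (hunif : TendstoUniformlyOn f id l (ball u r)) :
    ∀ᶠ n in l, ball u (r / 8) ⊆ f n '' ball u r := by
  have hloc : TendstoLocallyUniformlyOn f id l (ball u r) := hunif.tendstoLocallyUniformlyOn
  have hderiv := hloc.deriv (hf.mono fun n hn ↦ hn.1) isOpen_ball
  have h1 : Tendsto (fun n ↦ deriv (f n) u) l (𝓝 1) := by
    have := hderiv.tendsto_at (mem_ball_self hr)
    simpa [Function.comp_def] using this
  have h2 : Tendsto (fun n ↦ f n u) l (𝓝 u) := by
    have := hloc.tendsto_at (mem_ball_self hr)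
    simpa using this
  have h1' : ∀ᶠ n in l, 3 / 4 < ‖deriv (f n) u‖ := by
    have : ∀ᶠ n in l, dist (deriv (f n) u) 1 < 1 / 4 := h1 (ball_mem_nhds _ (by norm_num))
    filter_upwards [this] with n hn
    rw [dist_eq_norm] at hn
    have := norm_sub_norm_le (1 : ℂ) (deriv (f n) u)
    rw [norm_one, norm_sub_rev] at this
    linarith
  have h2' : ∀ᶠ n in l, dist (f n u) u < r / 16 := h2 (ball_mem_nhds _ (by positivity))
  filter_upwards [hf, h1', h2'] with n hn hd hc
  refine Subset.trans (fun v hv ↦ ?_) (ball_subset_image_of_injOn_ball hr hn.1 hn.2)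
  rw [mem_ball] at hv ⊢
  calc dist v (f n u) ≤ dist v u + dist u (f n u) := dist_triangle _ _ _
    _ < r / 8 + r / 16 := by rw [dist_comm u]; gcongr
    _ = r * (3 / 4) / 4 := by ring
    _ ≤ r * ‖deriv (f n) u‖ / 4 := by gcongr

/-! ### The domain `Ω_A` contains a disc about `0` and a neighbourhood of `∞` -/

section Annulus

variable {A : Set ℂ} (hA : IsPlusHull A) (hne : A.Nonempty)
include hA hne

/-- If `A ⊆ {δ ≤ |z|}` then `B(0, δ) ⊆ Ω_A` (`K_A = A ∪ Ā ∪ [x₀, x₁]` with `x₀ ≥ δ`). [folklore] -/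
theorem IsPlusHull.ball_subset_plusDomain {δ : ℝ} (hδ : ∀ z ∈ A, δ ≤ ‖z‖) :
    ball (0 : ℂ) δ ⊆ plusDomain A := by
  intro z hz
  rw [mem_ball_zero_iff] at hz
  rw [plusDomain_eq_compl, mem_compl_iff, plusCompact, slitCompact]
  have hx₀ : δ ≤ leftPt A := by
    have h1 := hδ _ (hA.leftPt_mem hne)
    rwa [Complex.norm_real, Real.norm_eq_abs, abs_of_pos (hA.leftPt_pos hne)] at h1
  rintro ((h | h) | h)
  · linarith [hδ z h]
  · have := hδ _ h
    rw [Complex.norm_conj] at this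
    linarith
  · rw [mem_realSeg_iff, uIcc_of_le (hA.leftPt_le_rightPt hne)] at h
    have h3 : ‖z‖ = |z.re| := by
      rw [← Complex.re_add_im z, h.1]; simp
    have := abs_re_le_norm z
    linarith [h.2.1, le_abs_self z.re]

/-- If `A ⊆ B̄(0, R)` then `{|z| > R} ⊆ Ω_A`. [folklore] -/
theorem IsPlusHull.mem_plusDomain_of_lt_norm {R : ℝ} (hR : ∀ z ∈ A, ‖z‖ ≤ R) {z : ℂ}
    (hz : R < ‖z‖) : z ∈ plusDomain A := by
  rw [plusDomain_eq_compl, mem_compl_iff, plusCompact, slitCompact]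
  have hx₁ : rightPt A ≤ R := by
    have h1 := hR _ (hA.rightPt_mem hne)
    rwa [Complex.norm_real, Real.norm_eq_abs, abs_of_pos (hA.rightPt_pos hne)] at h1
  have hx₀ : 0 < leftPt A := hA.leftPt_pos hne
  rintro ((h | h) | h)
  · linarith [hR z h]
  · have := hR _ h
    rw [Complex.norm_conj] at this
    linarith
  · rw [mem_realSeg_iff, uIcc_of_le (hA.leftPt_le_rightPt hne)] at h
    have h3 : ‖z‖ = |z.re| := by
      rw [← Complex.re_add_im z, h.1]; simp
    rw [abs_of_pos (hx₀.trans_le h.2.1)] at h3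
    linarith [h.2.2]

/-- `ζ⁻¹ ∈ Ω_A` for `|ζ| < δ` when `A ⊆ B̄(0, 1/δ)` (with `0⁻¹ = 0 ∈ Ω_A`). [folklore] -/
theorem IsPlusHull.inv_mem_plusDomain {δ : ℝ} (hδ0 : 0 < δ) (hR : ∀ z ∈ A, ‖z‖ ≤ δ⁻¹) {ζ : ℂ}
    (hζ : ‖ζ‖ < δ) : ζ⁻¹ ∈ plusDomain A := by
  rcases eq_or_ne ζ 0 with rfl | hζ0
  · rw [inv_zero]; exact hA.zero_mem_plusDomain hne
  · refine hA.mem_plusDomain_of_lt_norm hne hR ?_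
    rw [norm_inv]
    exact (inv_lt_inv₀ hδ0 (norm_pos_iff.2 hζ0)).2 hζ

/-! ### `E_A'(0) = Φ_A'(0)` -/

/-- **`E_A` has derivative `Φ_A'(0)` at `0`**: for any restriction map `Φ` of `A` with
`HasRestrictionDeriv A Φ d`, `E_A'(0) = d`. [cite: LawlerSchrammWerner2003Restriction, proof of Lemma 3.5 (p. 12), Cauchy's formula after Schwarz reflection] -/
theorem IsPlusHull.hasDerivAt_extMap_zero {Φ : ConformalEquiv (upperHalfPlaneSet \ A) upperHalfPlaneSet}
    (hΦ : IsRestrictionMap A Φ) {d : ℝ} (hd : HasRestrictionDeriv A Φ d) :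
    HasDerivAt (hA.extMap hne) (d : ℂ) 0 := by
  set h := hA.baseSlit hne
  have heq : hA.extMap hne =ᶠ[𝓝 0] h.ext :=
    Filter.eventually_of_mem (h.isOpen_slitDomain.mem_nhds h.zero_mem_slitDomain)
      fun _ hz ↦ hA.extMap_eq_base hne hz
  have h1 : HasDerivAt h.ext (h.restrictionDeriv : ℂ) 0 := by
    rw [← h.deriv_ext_zero]
    exact (h.differentiableAt_ext h.zero_mem_slitDomain).hasDerivAt
  have hdd : d = h.restrictionDeriv := by
    have h2 : HasRestrictionDeriv A (hA.baseMap hne) h.restrictionDeriv := h.hasRestrictionDeriv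
    have h3 : HasRestrictionDeriv A (hA.baseMap hne) d :=
      hd.congr' (eventually_nhdsWithin_of_forall fun z hz ↦ by rw [hA.eqOn_baseMap hne hΦ hz])
    exact h3.unique hA.1 h2
  rw [hdd]
  exact h1.congr_of_eventuallyEq heq

/-! ### Koebe at `0`: a uniform lower bound for `|E_A|` off `B(0, δ)` -/

/-- **Koebe at `0`**: if `A ⊆ {δ ≤ |z|}` then `E_A(B(0, δ)) ⊇ B(0, δ Φ_A'(0)/4)`.
[cite: Lawler2008, Thm. 3.17 (p. 62)] -/
theorem IsPlusHull.ball_subset_image_extMap {δ : ℝ} (hδ0 : 0 < δ) (hδ : ∀ z ∈ A, δ ≤ ‖z‖)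
    {Φ : ConformalEquiv (upperHalfPlaneSet \ A) upperHalfPlaneSet} (hΦ : IsRestrictionMap A Φ)
    {d : ℝ} (hd : HasRestrictionDeriv A Φ d) :
    ball (0 : ℂ) (δ * d / 4) ⊆ hA.extMap hne '' ball 0 δ := by
  have hsub := hA.ball_subset_plusDomain hne hδ
  have h := ball_subset_image_of_injOn_ball hδ0 ((hA.differentiableOn_extMap hne).mono hsub)
    ((hA.injOn_extMap hne).mono hsub)
  rw [hA.extMap_zero hne, (hA.hasDerivAt_extMap_zero hne hΦ hd).deriv, Complex.norm_real,
    Real.norm_eq_abs] at h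
  refine Subset.trans (ball_subset_ball ?_) h
  have := le_abs_self d
  nlinarith [hδ0.le]

/-- **Uniform lower bound**: if `A ⊆ {δ ≤ |z|}` then `|E_A(w)| ≥ δ Φ_A'(0)/4` for every
`w ∈ Ω_A` with `|w| ≥ δ` (Koebe at `0` and injectivity of `E_A`). [folklore] -/
theorem IsPlusHull.le_norm_extMap {δ : ℝ} (hδ0 : 0 < δ) (hδ : ∀ z ∈ A, δ ≤ ‖z‖)
    {Φ : ConformalEquiv (upperHalfPlaneSet \ A) upperHalfPlaneSet} (hΦ : IsRestrictionMap A Φ)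
    {d : ℝ} (hd : HasRestrictionDeriv A Φ d) {w : ℂ} (hw : w ∈ plusDomain A) (hwδ : δ ≤ ‖w‖) :
    δ * d / 4 ≤ ‖hA.extMap hne w‖ := by
  by_contra hlt
  rw [not_le] at hlt
  have hmem : hA.extMap hne w ∈ ball (0 : ℂ) (δ * d / 4) := mem_ball_zero_iff.2 hlt
  obtain ⟨z, hz, hzw⟩ := hA.ball_subset_image_extMap hne hδ0 hδ hΦ hd hmem
  have hzΩ := hA.ball_subset_plusDomain hne hδ hz
  have := hA.injOn_extMap hne hzΩ hw hzw
  subst this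
  rw [mem_ball_zero_iff] at hz
  linarith

/-! ### Koebe at `∞`: a uniform upper bound for `|E_A|` on `B(0, 2/δ)` -/

/-- `E_A → ∞` at `∞`. [folklore] -/
theorem IsPlusHull.tendsto_extMap_cobounded :
    Tendsto (hA.extMap hne) (cocompact ℂ) (cobounded ℂ) := by
  obtain ⟨R, -, hR⟩ := hA.exists_norm_le_norm_extMap hne
  have hn : Tendsto (fun z : ℂ ↦ ‖z‖ / 2) (cocompact ℂ) atTop :=
    tendsto_norm_cocompact_atTop.atTop_div_const (by norm_num)
  have hev : ∀ᶠ z in cocompact ℂ, ‖z‖ / 2 ≤ ‖hA.extMap hne z‖ := by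
    rw [← Metric.cobounded_eq_cocompact, Filter.hasBasis_cobounded_norm.eventually_iff]
    exact ⟨R, trivial, fun z hz ↦ hR z hz⟩
  have h : Tendsto (fun z ↦ ‖hA.extMap hne z‖) (cocompact ℂ) atTop := tendsto_atTop_mono' _ hev hn
  exact tendsto_norm_atTop_iff_cobounded.1 h

/-- **The inverted map `h(ζ) = 1/E_A(1/ζ)` is holomorphic and injective on `B(0, δ)` with
`h(0) = 0`, `h'(0) = 1`**, when `A ⊆ B̄(0, 1/δ)` (removable singularity at `0`: `E_A(z)/z → 1`).
[folklore] -/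
theorem IsPlusHull.inverted_extMap {δ : ℝ} (hδ0 : 0 < δ) (hR : ∀ z ∈ A, ‖z‖ ≤ δ⁻¹) :
    DifferentiableOn ℂ (fun ζ ↦ (hA.extMap hne ζ⁻¹)⁻¹) (ball 0 δ) ∧
      InjOn (fun ζ ↦ (hA.extMap hne ζ⁻¹)⁻¹) (ball 0 δ) ∧
      (hA.extMap hne (0 : ℂ)⁻¹)⁻¹ = 0 ∧ HasDerivAt (fun ζ ↦ (hA.extMap hne ζ⁻¹)⁻¹) 1 0 := by
  set E := hA.extMap hne with hE
  set g : ℂ → ℂ := fun ζ ↦ (E ζ⁻¹)⁻¹ with hg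
  have hE0 : E 0 = 0 := hA.extMap_zero hne
  have hg0 : g 0 = 0 := by simp [hg, hE0]
  have h0Ω : (0 : ℂ) ∈ plusDomain A := hA.zero_mem_plusDomain hne
  have hinvΩ : ∀ {ζ : ℂ}, ‖ζ‖ < δ → ζ⁻¹ ∈ plusDomain A := fun hζ ↦ hA.inv_mem_plusDomain hne hδ0 hR hζ
  -- `E(1/ζ) ≠ 0` for `0 < |ζ| < δ`
  have hEne : ∀ {ζ : ℂ}, ‖ζ‖ < δ → ζ ≠ 0 → E ζ⁻¹ ≠ 0 := fun {ζ} hζ hζ0 h ↦ by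
    have := hA.injOn_extMap hne (hinvΩ hζ) h0Ω (h.trans hE0.symm)
    exact hζ0 (inv_eq_zero.1 this)
  -- differentiability off `0`
  have hdiff : DifferentiableOn ℂ g (ball 0 δ \ {0}) := by
    rintro ζ ⟨hζ, hζ0⟩
    rw [mem_ball_zero_iff] at hζ
    have hζ0 : ζ ≠ 0 := hζ0
    have h1 : DifferentiableAt ℂ E ζ⁻¹ :=
      (hA.differentiableOn_extMap hne).differentiableAt (hA.isOpen_plusDomain.mem_nhds (hinvΩ hζ))
    exact ((h1.comp ζ (differentiableAt_inv hζ0)).inv (hEne hζ hζ0)).differentiableWithinAt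
  -- continuity at `0`
  have hcont : ContinuousAt g 0 := by
    rw [← continuousWithinAt_compl_self, ContinuousWithinAt, hg0]
    have h1 : Tendsto (fun ζ : ℂ ↦ E ζ⁻¹) (𝓝[≠] 0) (cobounded ℂ) :=
      (hA.tendsto_extMap_cobounded hne).comp
        (Metric.cobounded_eq_cocompact (α := ℂ) ▸ tendsto_inv₀_nhdsNE_zero)
    exact tendsto_inv₀_cobounded.comp h1
  have hball : ball (0 : ℂ) δ ∈ 𝓝 (0 : ℂ) := ball_mem_nhds _ hδ0
  have hdiff' : DifferentiableOn ℂ g (ball 0 δ) :=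
    (Complex.differentiableOn_compl_singleton_and_continuousAt_iff hball).1 ⟨hdiff, hcont⟩
  -- injectivity
  have hinj : InjOn g (ball 0 δ) := by
    intro ζ₁ h₁ ζ₂ h₂ heq
    rw [mem_ball_zero_iff] at h₁ h₂
    have h3 : E ζ₁⁻¹ = E ζ₂⁻¹ := inv_inj.1 heq
    have h4 := hA.injOn_extMap hne (hinvΩ h₁) (hinvΩ h₂) h3
    exact inv_inj.1 h4
  -- derivative at `0`
  have hderiv : HasDerivAt g 1 0 := by
    rw [hasDerivAt_iff_tendsto_slope_zero]
    have h1 : Tendsto (fun ζ : ℂ ↦ E ζ⁻¹ / ζ⁻¹) (𝓝[≠] 0) (𝓝 1) :=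
      (hA.tendsto_extMap_div hne).comp
        (Metric.cobounded_eq_cocompact (α := ℂ) ▸ tendsto_inv₀_nhdsNE_zero)
    have h2 := h1.inv₀ one_ne_zero
    rw [inv_one] at h2
    refine h2.congr' ?_
    filter_upwards [self_mem_nhdsWithin] with ζ hζ
    simp only [zero_add, smul_eq_mul, hg, inv_zero, hE0, sub_zero]
    rw [inv_div, div_eq_mul_inv]
  exact ⟨hdiff', hinj, hg0, hderiv⟩

/-- **Uniform upper bound**: if `A ⊆ B̄(0, 1/δ)` then `|E_A(w)| ≤ 8/δ` for every `w ∈ Ω_A` with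
`|w| ≤ 2/δ`. Proof: by Koebe's one-quarter theorem for `h(ζ) = 1/E_A(1/ζ)` on `B(0, δ/2)`,
`E_A({|z| > 2/δ}) ⊇ {|u| > 8/δ}`, and `E_A` is injective on `Ω_A`. [folklore] -/
theorem IsPlusHull.norm_extMap_le {δ : ℝ} (hδ0 : 0 < δ) (hR : ∀ z ∈ A, ‖z‖ ≤ δ⁻¹) {w : ℂ}
    (hw : w ∈ plusDomain A) (hw2 : ‖w‖ ≤ 2 / δ) : ‖hA.extMap hne w‖ ≤ 8 / δ := by
  obtain ⟨hgd, hginj, hg0, hgderiv⟩ := hA.inverted_extMap hne hδ0 hR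
  set E := hA.extMap hne with hE
  set g : ℂ → ℂ := fun ζ ↦ (E ζ⁻¹)⁻¹ with hg
  by_contra hlt
  rw [not_le] at hlt
  have hEw0 : E w ≠ 0 := by
    intro h0
    rw [h0, norm_zero] at hlt
    have : (0 : ℝ) < 8 / δ := by positivity
    linarith
  -- Koebe for `g` on `B(0, δ/2)`
  have hδ2 : 0 < δ / 2 := by positivity
  have hsub : ball (0 : ℂ) (δ / 2) ⊆ ball 0 δ := ball_subset_ball (by linarith)
  have hK := ball_subset_image_of_injOn_ball hδ2 (hgd.mono hsub) (hginj.mono hsub)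
  rw [show g 0 = 0 from hg0, hgderiv.deriv, norm_one, mul_one] at hK
  -- `v = 1/E(w)` has `|v| < δ/8`
  have hv : (E w)⁻¹ ∈ ball (0 : ℂ) (δ / 2 / 4) := by
    rw [mem_ball_zero_iff, norm_inv]
    have h8 : 0 < 8 / δ := by positivity
    calc ‖E w‖⁻¹ < (8 / δ)⁻¹ := (inv_lt_inv₀ (h8.trans hlt) h8).2 hlt
      _ = δ / 2 / 4 := by field_simp; ring
  obtain ⟨ζ, hζ, hζv⟩ := hK hv
  rw [mem_ball_zero_iff] at hζ
  have hζ0 : ζ ≠ 0 := by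
    rintro rfl
    rw [show g 0 = 0 from hg0] at hζv
    exact inv_ne_zero hEw0 hζv.symm
  -- so `E(1/ζ) = E(w)` and `1/ζ = w`
  have h1 : E ζ⁻¹ = E w := inv_inj.1 hζv
  have hζΩ : ζ⁻¹ ∈ plusDomain A := hA.inv_mem_plusDomain hne hδ0 hR (hζ.trans (by linarith))
  have h2 : ζ⁻¹ = w := hA.injOn_extMap hne hζΩ hw h1
  rw [← h2, norm_inv] at hw2
  have h3 : 2 / δ < ‖ζ‖⁻¹ := by
    rw [lt_inv_comm₀ (by positivity) (norm_pos_iff.2 hζ0)]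
    calc (2 / δ)⁻¹ = δ / 2 := by field_simp
      _ > ‖ζ‖ := hζ
  linarith

end Annulus

end Literature.Probability.RandomPlanarGeometry

end
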